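/-
Copyright (c) 2026 the pub-hodgecm-mathlib formalisation cell (harness21).  Prover seat hodgecm-mathlib-F0P3a-p04 (g31), 2026-09-03.  E1 row 47d «ASSEMBLY» — glue G3
(E1 keeper F0P3a-p03 (g29) 02:28:58Z; interim reader F0P3a-p09 (g15) 02:46:02Z∕02:46:28Z «G1–G4 type now»; census row 47 `CENSUS-NONELL-VANISHING.v1` (F0P3-p02 (g26)) §2 (A2)–(A3)).
-/
import Literature.NumberTheory.Automorphic.CompactOpenAveragingCompose   -- ★ row 33: `avgProj_mem_fixedPoints`, `avgProj_of_mem_fixedPoints`; brings ★ `CompactOpenAveraging` (`avgProj_eq`, `mem_span_of_sum_eq_zero`, `exists_isLeftTransversal`, `avgProjLinear`)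
import Mathlib.RepresentationTheory.Coinvariants
import Mathlib.RepresentationTheory.Intertwining
import Mathlib.LinearAlgebra.FreeModule.Finite.Matrix
import HarnessLib

/-!
# Intertwiners into a character: `Hom_C(Q, χ-line) ≅ Hom_k(Q_{(C,χ)}, line)` and, for a compact group, `dim Hom_C(Q, χ-line) = dim {q | σ c q = χ c • q}`
# (Serre 1977 §2.3; Bernstein–Zelevinsky 1976 §2.3; Casselman 1995 §2.1)

Topic `NumberTheory/Automorphic`; declarations in Mathlib's `Representation` namespace (dot-style, as ★ `CompactOpenAveraging*`).  THEOREMS ONLY (no definition, no instance, no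
notation, no named fact, no `sorry`): the twisted representation `σ ⊗ χ⁻¹` is carried HYPOTHESIS-STYLE (`hσ′ : ∀ c q, σ′ c q = (χ c)⁻¹ • σ c q`, scalars in `k`) and supplied by an
`∃`-head.  Cell `pub/hodgecm-mathlib` (D-0151), crux H413 = `stmt-HodgeConjecture-24833`, lane `--supports`; E1 BRICK LEDGER row 47d (census row 47 §5 R47-d ASSEMBLY
«`tr (i_B χ)(f_EP^{V,e}) = 0`»), glue (G3): the bridge between the Mackey side (★ 47b: local terms `dim Hom_{P_F ∩ g⁻¹Bg}(V^{U_F}, (χδ^{1∕2})^g)`, i.e. `dim Hom_{T_c}(Q, χ′-line)` after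
transport and semidirect Frobenius) and the Jacquet side (★ 47c∕4χ: dimensions of the `χ′`-EIGENSPACES of the compact torus `T_c` on the coinvariant blocks `Q`).  HONEST LABEL:
count-neutral generic base layer; (R-SS) NOT chartered; E1 = PRINT until the keeper's charter test; HC_CM is proved only modulo the 2 remaining named inputs (hLiu418 =
`stmt-HodgeConjecture-24832`, h413 = `stmt-HodgeConjecture-24833`) until rung 0 closes.

THE MATHEMATICS.  `C` a group, `σ` a representation on `Q`, `χ : C →* kˣ`, `σ_W` the `χ`-representation on `W` (`σ_W c = χ c • id`), `σ′ = σ ⊗ χ⁻¹` (`σ′ c = (χ c)⁻¹ σ c`).  (§1–§2)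
`Hom_C(σ, σ_W) = {φ | φ ∘ σ′ c = φ ∀ c} ≃ₗ Hom_k(Q_{σ′}, W)` (`Q_{σ′}` = Mathlib `Coinvariants σ′`, via `Coinvariants.lift`), so `dim Hom_C(σ, σ_W) = dim Q_{σ′} · dim W`; the
invariants `Q^{σ′}` are exactly the `χ`-eigenvectors of `σ`.  (§3) For `C` a COMPACT subgroup of a topological group `G` acting SMOOTHLY (`σ′` the restriction of a smooth `G`- or
`C`-representation) on a finite-dimensional `Q`, `char k = 0`: the quotient map restricts to an isomorphism `Q^{C} ≃ Q_{C}` — injective because the averaging projector `e_C`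
(★ `avgProj`) is the identity on `Q^C` and kills every `σ′ c q − q`, surjective because `q − e_C q` lies in the coinvariant kernel (`Σ_{r ∈ R} σ′ r (q − e_C q) = 0` over a transversal
`R`, ★ `mem_span_of_sum_eq_zero`).  Hence **`dim Hom_C(σ, χ-line) = dim {q | ∀ c, σ c q = χ c • q}`** [Serre 1977 §2.3 «the number of `W_i` isomorphic to `W` equals `⟨φ, χ⟩`»].

* §1 `exists_twistInv`, `mem_fixedPoints_twistInv_iff` (invariants of the twist = `χ`-eigenvectors), `comp_twistInv_eq_iff`.
* §2 **`nonempty_intertwiningMap_character_linearEquiv_coinvariants`** (`Hom_C(σ, σ_W) ≃ₗ (Coinvariants σ′ →ₗ W)`), `finrank_intertwiningMap_character_eq_mul`.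
* §3 COMPACT `C ≤ G`: `sub_avgProj_mem_coinvariantsKer`, `avgProj_eq_zero_of_mem_coinvariantsKer`, **`nonempty_fixedPoints_linearEquiv_coinvariants`** (`Q^C ≃ₗ Q_C`),
  `finrank_coinvariants_eq_finrank_fixedPoints`, `coinvariantsKer_eq_of_forall_apply_eq`, **`finrank_intertwiningMap_character_eq_finrank_fixedPoints`** (G3).

## References
* [Serre1977] J.-P. Serre, *Linear Representations of Finite Groups*, GTM 42 (1977): §2.3 (multiplicity of an irreducible = `dim Hom`; here the `1`-dimensional case).
* [BernsteinZelevinsky1976] I. N. Bernstein, A. V. Zelevinsky, *Representations of the group GL(n, F)*, Russian Math. Surveys 31 (1976): §2.3 (coinvariants; averaging over compact subgroups).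
* [Casselman1995] W. Casselman, *Introduction to the theory of admissible representations of p-adic reductive groups*: §2.1 (the projector `𝒫_K`, `V = V^K ⊕ V(K)`).
-/

set_option autoImplicit false

open scoped BigOperators

namespace Representation

/-! ## §1 The twisted representation `σ ⊗ χ⁻¹`: existence, invariants = `χ`-eigenvectors -/

section Twist

variable {k C Q : Type*} [Field k] [Group C] [AddCommGroup Q] [Module k Q] (σ : Representation k C Q) (χ : C →* kˣ)

/-- **THE TWIST `σ ⊗ χ⁻¹` EXISTS**: a representation `σ′` of `C` on the same space with `σ′ c q = (χ c)⁻¹ • σ c q`. [cite: BernsteinZelevinsky1976, §2.3] -/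
theorem exists_twistInv : ∃ σ' : Representation k C Q, ∀ (c : C) (q : Q), σ' c q = ((χ c : kˣ) : k)⁻¹ • σ c q := by
  refine ⟨{ toFun := fun c => ((χ c : kˣ) : k)⁻¹ • σ c, map_one' := ?_, map_mul' := fun c c' => ?_ }, fun c q => rfl⟩
  · rw [map_one, Units.val_one, inv_one, map_one, one_smul]
  · apply LinearMap.ext
    intro q
    simp only [map_mul, Units.val_mul, mul_inv, LinearMap.smul_apply, Module.End.mul_apply, LinearMap.map_smul, smul_smul]

variable {σ χ} {σ' : Representation k C Q} (hσ' : ∀ (c : C) (q : Q), σ' c q = ((χ c : kˣ) : k)⁻¹ • σ c q)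
include hσ'

/-- `σ c q = χ c • σ′ c q` (the twist undone). [cite: BernsteinZelevinsky1976, §2.3] -/
theorem apply_eq_smul_twistInv (c : C) (q : Q) : σ c q = ((χ c : kˣ) : k) • σ' c q := by
  rw [hσ', smul_smul, mul_inv_cancel₀ (χ c).ne_zero, one_smul]

/-- The invariants of `σ ⊗ χ⁻¹` are the `χ`-EIGENVECTORS of `σ`: `q ∈ Q^{σ′(S)} ↔ ∀ c ∈ S, σ c q = χ c • q`. [cite: Serre1977, §2.3] -/
theorem mem_fixedPoints_twistInv_iff (S : Subgroup C) (q : Q) : q ∈ σ'.fixedPoints S ↔ ∀ c ∈ S, σ c q = ((χ c : kˣ) : k) • q := by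
  rw [mem_fixedPoints]
  refine forall₂_congr fun c _ => ?_
  rw [apply_eq_smul_twistInv hσ' c q]
  constructor
  · intro h
    rw [h]
  · intro h
    have hne : ((χ c : kˣ) : k) ≠ 0 := (χ c).ne_zero
    exact smul_right_injective Q hne (by simpa using h)

/-- `φ` intertwines `σ` with the character representation `σ_W` (`σ_W c = χ c • id`) iff `φ ∘ σ′ c = φ` for all `c`. [cite: Serre1977, §2.3] -/
theorem comp_twistInv_eq_iff {W : Type*} [AddCommGroup W] [Module k W] (σW : Representation k C W) (hW : ∀ (c : C) (w : W), σW c w = ((χ c : kˣ) : k) • w)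
    (φ : Q →ₗ[k] W) : (∀ c : C, φ ∘ₗ σ' c = φ) ↔ ∀ (c : C) (q : Q), φ (σ c q) = σW c (φ q) := by
  constructor
  · intro h c q
    rw [apply_eq_smul_twistInv hσ' c q, map_smul, hW]
    congr 1
    exact LinearMap.congr_fun (h c) q
  · intro h c
    apply LinearMap.ext
    intro q
    rw [LinearMap.comp_apply, hσ', map_smul, h, hW, smul_smul, inv_mul_cancel₀ (χ c).ne_zero, one_smul]

end Twist

/-! ## §2 `Hom_C(σ, σ_W) ≃ₗ Hom_k(Coinvariants (σ ⊗ χ⁻¹), W)` -/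

section HomCoinvariants

variable {k C Q W : Type*} [Field k] [Group C] [AddCommGroup Q] [Module k Q] [AddCommGroup W] [Module k W]
  {σ : Representation k C Q} {χ : C →* kˣ} {σ' : Representation k C Q} (hσ' : ∀ (c : C) (q : Q), σ' c q = ((χ c : kˣ) : k)⁻¹ • σ c q)
  {σW : Representation k C W} (hW : ∀ (c : C) (w : W), σW c w = ((χ c : kˣ) : k) • w)
include hσ' hW

/-- **`Hom_C(σ, σ_W) ≃ₗ Hom_k(Q_{σ ⊗ χ⁻¹}, W)`**: an intertwiner into the `χ`-representation is a linear map invariant under `σ ⊗ χ⁻¹`, i.e. a linear map on its coinvariants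
(Mathlib `Coinvariants.lift`). [cite: Serre1977, §2.3] [cite: BernsteinZelevinsky1976, §2.3] -/
theorem nonempty_intertwiningMap_character_linearEquiv_coinvariants :
    ∃ e : IntertwiningMap σ σW ≃ₗ[k] (σ'.Coinvariants →ₗ[k] W), ∀ (φ : IntertwiningMap σ σW) (q : Q), e φ (Coinvariants.mk σ' q) = φ q := by
  -- `[σ c q] = χ c • [q]` in the coinvariants of `σ′`
  have hmk : ∀ (c : C) (q : Q), Coinvariants.mk σ' (σ c q) = ((χ c : kˣ) : k) • Coinvariants.mk σ' q := fun c q => by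
    rw [apply_eq_smul_twistInv hσ' c q, map_smul, Coinvariants.mk_self_apply]
  refine ⟨{ toFun := fun φ => Coinvariants.lift σ' φ.toLinearMap ((comp_twistInv_eq_iff hσ' σW hW φ.toLinearMap).2 fun c q => IntertwiningMap.isIntertwining σ σW φ c q)
            map_add' := fun φ ψ => Coinvariants.hom_ext (by ext q; rfl)
            map_smul' := fun a φ => Coinvariants.hom_ext (by ext q; rfl)
            invFun := fun ψ => LinearMap.intertwiningMap_of_isIntertwiningMap σ σW (ψ ∘ₗ Coinvariants.mk σ') (fun c q => by
              rw [LinearMap.comp_apply, LinearMap.comp_apply, hmk, map_smul, hW])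
            left_inv := fun φ => IntertwiningMap.ext (by ext q; rfl)
            right_inv := fun ψ => Coinvariants.hom_ext (by ext q; rfl) }, fun φ q => rfl⟩

/-- **`dim Hom_C(σ, σ_W) = dim Q_{σ ⊗ χ⁻¹} · dim W`**. [cite: Serre1977, §2.3] -/
theorem finrank_intertwiningMap_character_eq_mul [FiniteDimensional k Q] [FiniteDimensional k W] :
    Module.finrank k (IntertwiningMap σ σW) = Module.finrank k σ'.Coinvariants * Module.finrank k W := by
  obtain ⟨e, -⟩ := nonempty_intertwiningMap_character_linearEquiv_coinvariants hσ' hW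
  rw [e.finrank_eq, Module.finrank_linearMap]

end HomCoinvariants

/-! ## §3 Compact `C ≤ G`, smooth finite-dimensional `Q`: `Q^{C} ≃ Q_{C}` and `dim Hom_C(σ, χ-line) = dim Q^{σ ⊗ χ⁻¹}` -/

section Compact

variable {k G Q : Type*} [Field k] [CharZero k] [Group G] [TopologicalSpace G] [IsTopologicalGroup G] [AddCommGroup Q] [Module k Q]
  (σ' : Representation k G Q) {C : Subgroup G}

/-- **`q − e_C q` LIES IN THE COINVARIANT KERNEL OF `C`** for a smooth vector `q` and a compact `C` (`e_C q = |R|⁻¹ Σ_{r∈R} σ′ r q` over a transversal `R`, and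
`Σ_r σ′ r (q − e_C q) = 0`, ★ `mem_span_of_sum_eq_zero`). [cite: BernsteinZelevinsky1976, §2.3] [cite: Casselman1995, §2.1] -/
theorem sub_avgProj_mem_coinvariantsKer (hC : IsCompact (C : Set G)) {q : Q} (hq : σ'.IsSmoothVector q) :
    q - σ'.avgProj C q ∈ Coinvariants.ker (σ'.comp C.subtype) := by
  classical
  obtain ⟨R, hR⟩ := Literature.NumberTheory.Automorphic.exists_isLeftTransversal (B := C) hC hq
  have havg := σ'.avgProj_eq hC hq (fun t ht => (σ'.mem_stabilizerSubgroup q t).1 ht) hR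
  have hfix : ∀ r ∈ R, σ' r (σ'.avgProj C q) = σ'.avgProj C q := fun r hr => apply_avgProj hC hq (hR.mem_of_mem r hr)
  have hsum : ∑ r ∈ R, σ' r (q - σ'.avgProj C q) = 0 := by
    simp only [map_sub]
    rw [Finset.sum_sub_distrib, Finset.sum_congr rfl hfix, Finset.sum_const, havg, ← Nat.cast_smul_eq_nsmul k, smul_smul,
      mul_inv_cancel₀ (Nat.cast_ne_zero.2 (Finset.card_ne_zero.2 hR.nonempty)), one_smul, sub_self]
  have hmem := mem_span_of_sum_eq_zero (ρ := σ') hR hsum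
  refine Submodule.span_le.2 ?_ hmem
  rintro _ ⟨u, hu, x, rfl⟩
  exact Coinvariants.mem_ker_of_eq (ρ := σ'.comp C.subtype) ⟨u, hu⟩ x _ rfl

/-- **`e_C` KILLS THE COINVARIANT KERNEL OF `C`** (`σ′` smooth, `C` compact): `e_C(σ′ c x − x) = 0` and linearity. [cite: BernsteinZelevinsky1976, §2.3] [cite: Casselman1995, §2.1] -/
theorem avgProj_eq_zero_of_mem_coinvariantsKer (hC : IsCompact (C : Set G)) (hsm : σ'.IsSmooth) {x : Q} (hx : x ∈ Coinvariants.ker (σ'.comp C.subtype)) :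
    σ'.avgProj C x = 0 := by
  rw [← avgProjLinear_apply C hsm hC]
  refine Submodule.span_induction (p := fun x _ => σ'.avgProjLinear C hsm hC x = 0) ?_ (map_zero _) (fun x y _ _ hx hy => by rw [map_add, hx, hy, add_zero])
    (fun a x _ hx => by rw [map_smul, hx, smul_zero]) hx
  rintro _ ⟨⟨c, y⟩, rfl⟩
  change σ'.avgProjLinear C hsm hC (σ' (c : G) y - y) = 0
  rw [map_sub, avgProjLinear_apply, avgProjLinear_apply, avgProj_apply_of_mem hC (hsm y) c.2, sub_self]

/-- **`Q^{C} ≃ₗ Q_{C}` for a compact `C` acting smoothly on `Q`** (`char k = 0`; no finiteness needed): the quotient map restricted to the invariants is injective (`e_C` is the identity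
on `Q^C` and kills the coinvariant kernel) and surjective (`[q] = [e_C q]`). [cite: BernsteinZelevinsky1976, §2.3] [cite: Casselman1995, §2.1] -/
theorem nonempty_fixedPoints_linearEquiv_coinvariants (hC : IsCompact (C : Set G)) (hsm : σ'.IsSmooth) :
    ∃ e : σ'.fixedPoints C ≃ₗ[k] Coinvariants (σ'.comp C.subtype), ∀ v : σ'.fixedPoints C, e v = Coinvariants.mk (σ'.comp C.subtype) (v : Q) := by
  let f : σ'.fixedPoints C →ₗ[k] Coinvariants (σ'.comp C.subtype) := Coinvariants.mk (σ'.comp C.subtype) ∘ₗ (σ'.fixedPoints C).subtype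
  have hinj : Function.Injective f := by
    rw [← LinearMap.ker_eq_bot, Submodule.eq_bot_iff]
    rintro ⟨v, hv⟩ hfv
    have h0 : Coinvariants.mk (σ'.comp C.subtype) v = 0 := hfv
    rw [Coinvariants.mk_eq_zero] at h0
    have h1 := avgProj_eq_zero_of_mem_coinvariantsKer σ' hC hsm h0
    rw [avgProj_of_mem_fixedPoints hC (hsm v) hv] at h1
    exact Subtype.ext h1
  have hsurj : Function.Surjective f := by
    intro x
    obtain ⟨q, rfl⟩ := Coinvariants.mk_surjective (σ'.comp C.subtype) x
    refine ⟨⟨σ'.avgProj C q, avgProj_mem_fixedPoints hC (hsm q)⟩, ?_⟩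
    change Coinvariants.mk _ (σ'.avgProj C q) = Coinvariants.mk _ q
    rw [Coinvariants.mk_eq_iff, ← Submodule.neg_mem_iff, neg_sub]
    exact sub_avgProj_mem_coinvariantsKer σ' hC (hsm q)
  exact ⟨LinearEquiv.ofBijective f ⟨hinj, hsurj⟩, fun v => rfl⟩

/-- **`dim Q_C = dim Q^C`** for a compact `C` acting smoothly on `Q`. [cite: BernsteinZelevinsky1976, §2.3] [cite: Casselman1995, §2.1] -/
theorem finrank_coinvariants_eq_finrank_fixedPoints (hC : IsCompact (C : Set G)) (hsm : σ'.IsSmooth) :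
    Module.finrank k (Coinvariants (σ'.comp C.subtype)) = Module.finrank k (σ'.fixedPoints C) := by
  obtain ⟨e, -⟩ := nonempty_fixedPoints_linearEquiv_coinvariants σ' hC hsm
  exact e.finrank_eq.symm

omit [CharZero k] [TopologicalSpace G] [IsTopologicalGroup G] in
/-- The coinvariant kernel of a `C`-representation agreeing with `σ′|_C` IS that of `σ′|_C` (both are `span {σ′ c q − q}`). [cite: BernsteinZelevinsky1976, §2.3] -/
theorem coinvariantsKer_eq_of_forall_apply_eq {σC : Representation k C Q} (hσC : ∀ (c : C) (q : Q), σC c q = σ' (c : G) q) :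
    Coinvariants.ker σC = Coinvariants.ker (σ'.comp C.subtype) := by
  unfold Coinvariants.ker
  congr 1
  ext x
  simp only [Set.mem_range, Prod.exists, hσC]
  rfl

variable {W : Type*} [AddCommGroup W] [Module k W]

/-- **(G3) `dim Hom_C(τ, χ-line) = dim Q^{σ′(C)}`**, `σ′ = τ ⊗ χ⁻¹`: for a COMPACT subgroup `C ≤ G` and a `C`-representation `τ` on a finite-dimensional `Q` (`char k = 0`) whose twist
`σ_C = τ ⊗ χ⁻¹` (`hτ`) is the restriction of a SMOOTH `σ′` (`hσC`, `hsm`; e.g. `σ′` itself a `C`-representation read through `G = C`), `χ : C →* kˣ`, and `σ_W` the `χ`-representation on a LINE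
`W` (`dim W = 1`): `dim Hom_C(τ, σ_W) = dim σ′.fixedPoints C` — and `σ′.fixedPoints C = {q | ∀ c ∈ C, τ c q = χ c • q}` by `mem_fixedPoints_twistInv_iff` (read through `hσC`).
Proof: §2 + `dim Q_{σ_C} = dim Q_{σ′|_C} = dim Q^{σ′(C)}`. [cite: Serre1977, §2.3] [cite: BernsteinZelevinsky1976, §2.3] -/
theorem finrank_intertwiningMap_character_eq_finrank_fixedPoints [FiniteDimensional k Q] [FiniteDimensional k W] (hC : IsCompact (C : Set G)) (hsm : σ'.IsSmooth)
    {σC : Representation k C Q} (hσC : ∀ (c : C) (q : Q), σC c q = σ' (c : G) q)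
    {τ : Representation k C Q} {χ : C →* kˣ} (hτ : ∀ (c : C) (q : Q), σC c q = ((χ c : kˣ) : k)⁻¹ • τ c q)
    {σW : Representation k C W} (hW : ∀ (c : C) (w : W), σW c w = ((χ c : kˣ) : k) • w) (hW1 : Module.finrank k W = 1) :
    Module.finrank k (IntertwiningMap τ σW) = Module.finrank k (σ'.fixedPoints C) := by
  rw [finrank_intertwiningMap_character_eq_mul hτ hW, hW1, mul_one]
  have e : σC.Coinvariants ≃ₗ[k] Coinvariants (σ'.comp C.subtype) := Submodule.quotEquivOfEq _ _ (coinvariantsKer_eq_of_forall_apply_eq σ' hσC)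
  rw [e.finrank_eq, finrank_coinvariants_eq_finrank_fixedPoints σ' hC hsm]

end Compact

end Representation
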